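import Mathlib.LinearAlgebra.Matrix.Rank
import Mathlib.LinearAlgebra.FiniteDimensional.Lemmas
import HarnessLib

/-!
# The slice rank method: Tao's lemma and tricolored sum-free sets

Topic: `Literature/Combinatorics/Additive`. Vendored for the proof of
Blasiak–Church–Cohn–Grochow–Naslund–Sawin–Umans 2017, Thm. A/B (bounded-exponent abelian groups
cannot give `ω = 2` via STPP constructions), §4 of that paper ("Tricolored sum-free sets in abelian
groups of bounded exponent via rank and instability of tensors"), following Tao's symmetric
formulation of the Croot–Lev–Pach–Ellenberg–Gijswijt method. Everything here is PROVED.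

* `HasSliceRankLE D k` — the 3-tensor (function) `D : X → Y → Z → K` is a sum of at most `k`
  *slices* `f(x) g(y,z)`, `f(y) g(x,z)`, `f(z) g(x,y)` (BCCGNSU 2017, (4.1); i.e. `slicerank D ≤ k`;
  the tree's `Literature.Barriers.MatrixMultiplication.sliceRank`
  (`Literature/Barriers/MatrixMultiplication/UniversalMethodBarrier.lean`, not imported here to
  keep this file free of a `Barriers` dependency) is the infimum of `kx + ky + kz` over the same
  decompositions, written there as an equality of functions). API: `mono`,
  `hasSliceRankLE_of_fintype` (decompositions indexed
  by finite types), `comp` (restriction/pull-back along maps of the coordinates, BCCGNSU proof of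
  Prop. 4.8), `mul_tensor` (BCCGNSU Prop. 4.2, second claim: `slicerank (D ⊗ E) ≤ slicerank D · |W|`
  for `E` on `W³`), `hasSliceRankLE_of_cover` (the grouping step of BCCGNSU Thm. 4.10 /
  Prop. 4.13: a rank-one decomposition whose index set is covered by three classes on which the
  `x`-, `y`-, resp. `z`-factor takes few values is a slice decomposition).
* `HasSliceRankLE.card_le_of_diagonal` — **Tao's lemma** (BCCGNSU Lemma 4.7, Tao's proof): a
  diagonal tensor with nonzero diagonal on `X³` needs `|X|` slices; `card_le_of_matching` is the
  pulled-back form used for sum-free sets. Ingredient `exists_mem_finrank_le_card_support`: a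
  subspace `V ≤ K^X` contains a vector with at least `dim V` nonzero coordinates.
* `IsTricoloredSumFree s t u` — BCCGNSU Def. 3.1 in functional form (`s i + t j + u k = 0 ↔
  i = j = k`), with `IsTricoloredSumFree.card_le` = BCCGNSU Prop. 4.8 (`|M| ≤ slicerank D_H`,
  `D_H(x,y,z) = [x + y + z = 0]`, over any field).

## References

* J. Blasiak, T. Church, H. Cohn, J. A. Grochow, E. Naslund, W. F. Sawin, C. Umans, *On cap sets
  and the group-theoretic approach to matrix multiplication*, Discrete Analysis 2017:3,
  arXiv:1605.06702: Def. 3.1 (p. 6), §4.1 eq. (4.1) (p. 10), Prop. 4.2 (p. 11), Lemma 4.7 and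
  Prop. 4.8 (p. 13), proof of Thm. 4.10 (p. 14). (Page numbers of the held 19-page PDF,
  `lit read arxiv:1605.06702 --pages …`.)
* T. Tao, *A symmetric formulation of the Croot–Lev–Pach–Ellenberg–Gijswijt capset bound*, blog
  post, 18 May 2016 (the source of Lemma 4.7, cited as [T] by BCCGNSU).

## Design notes

* Slice decompositions are `Fin`-indexed inside `HasSliceRankLE` (universe-clean, matches the
  tree's `sliceRank`); `hasSliceRankLE_of_fintype` converts from arbitrary finite index types.
* Tao's lemma is proved exactly as printed (annihilator `V` of the `x`-slices, a vector `u ∈ V` of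
  maximal support, contraction to a `Y × Z` matrix of rank `< |X| - j` versus a diagonal matrix of
  rank `≥ |X| - j`), with `Matrix.rank`, `Matrix.rank_diagonal`, `Matrix.rank_vecMulVec_le`.
-/

namespace Literature.Combinatorics.Additive

open Finset Matrix

universe u

section SliceRank

variable {K : Type*} [Field K]
variable {X Y Z : Type*}

/-- **Slice rank at most `k`** (BCCGNSU 2017, eq. (4.1); Tao): the function
`D : X → Y → Z → K` can be written as
`D(x,y,z) = Σ_{r<kx} f₁ʳ(x) g₁ʳ(y,z) + Σ_{r<ky} f₂ʳ(y) g₂ʳ(x,z) + Σ_{r<kz} f₃ʳ(z) g₃ʳ(x,y)` with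
`kx + ky + kz ≤ k`. (So `slicerank D = min {k | HasSliceRankLE D k}`; cf. the tree's
`Literature.Barriers.MatrixMultiplication.sliceRank`, the infimum of `kx + ky + kz` over the same decompositions.)
[cite: BlasiakChurchCohnGrochowNaslundSawinUmans2017, §4.1 (4.1)] -/
def HasSliceRankLE (D : X → Y → Z → K) (k : ℕ) : Prop :=
  ∃ kx ky kz : ℕ, kx + ky + kz ≤ k ∧
    ∃ (f₁ : Fin kx → X → K) (g₁ : Fin kx → Y → Z → K) (f₂ : Fin ky → Y → K)
      (g₂ : Fin ky → X → Z → K) (f₃ : Fin kz → Z → K) (g₃ : Fin kz → X → Y → K),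
      ∀ x y z, D x y z =
        (∑ r, f₁ r x * g₁ r y z) + (∑ r, f₂ r y * g₂ r x z) + (∑ r, f₃ r z * g₃ r x y)

/-- Monotonicity in the bound. [folklore] -/
theorem HasSliceRankLE.mono {D : X → Y → Z → K} {k k' : ℕ} (h : HasSliceRankLE D k) (hk : k ≤ k') :
    HasSliceRankLE D k' := by
  obtain ⟨kx, ky, kz, hle, rest⟩ := h
  exact ⟨kx, ky, kz, hle.trans hk, rest⟩

/-- A slice decomposition indexed by arbitrary finite types `R₁, R₂, R₃` witnesses
`HasSliceRankLE D (|R₁| + |R₂| + |R₃|)` (reindex along `Fintype.equivFin`). [folklore] -/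
theorem hasSliceRankLE_of_fintype {R₁ R₂ R₃ : Type*} [Fintype R₁] [Fintype R₂] [Fintype R₃]
    (D : X → Y → Z → K) (f₁ : R₁ → X → K) (g₁ : R₁ → Y → Z → K) (f₂ : R₂ → Y → K)
    (g₂ : R₂ → X → Z → K) (f₃ : R₃ → Z → K) (g₃ : R₃ → X → Y → K)
    (hD : ∀ x y z, D x y z =
      (∑ r, f₁ r x * g₁ r y z) + (∑ r, f₂ r y * g₂ r x z) + (∑ r, f₃ r z * g₃ r x y)) :
    HasSliceRankLE D (Fintype.card R₁ + Fintype.card R₂ + Fintype.card R₃) := by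
  classical
  set e₁ := Fintype.equivFin R₁
  set e₂ := Fintype.equivFin R₂
  set e₃ := Fintype.equivFin R₃
  refine ⟨_, _, _, le_rfl, fun r => f₁ (e₁.symm r), fun r => g₁ (e₁.symm r),
    fun r => f₂ (e₂.symm r), fun r => g₂ (e₂.symm r), fun r => f₃ (e₃.symm r),
    fun r => g₃ (e₃.symm r), fun x y z => ?_⟩
  rw [hD x y z]
  congr 1
  congr 1
  · exact (e₁.symm.sum_comp (fun r => f₁ r x * g₁ r y z)).symm
  · exact (e₂.symm.sum_comp (fun r => f₂ r y * g₂ r x z)).symm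
  · exact (e₃.symm.sum_comp (fun r => f₃ r z * g₃ r x y)).symm

/-- Slice decompositions pull back along arbitrary maps of the three coordinates (in particular
restrict to sub-boxes: BCCGNSU 2017, first display in the proof of Prop. 4.8,
`slicerank (F|_{X₀×Y₀×Z₀}) ≤ slicerank F`).
[cite: BlasiakChurchCohnGrochowNaslundSawinUmans2017, Prop. 4.8 (proof)] -/
theorem HasSliceRankLE.comp {D : X → Y → Z → K} {k : ℕ} (h : HasSliceRankLE D k)
    {X' Y' Z' : Type*} (φ : X' → X) (ψ : Y' → Y) (χ : Z' → Z) :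
    HasSliceRankLE (fun x y z => D (φ x) (ψ y) (χ z)) k := by
  obtain ⟨kx, ky, kz, hle, f₁, g₁, f₂, g₂, f₃, g₃, hD⟩ := h
  exact ⟨kx, ky, kz, hle, fun r x => f₁ r (φ x), fun r y z => g₁ r (ψ y) (χ z),
    fun r y => f₂ r (ψ y), fun r x z => g₂ r (φ x) (χ z), fun r z => f₃ r (χ z),
    fun r x y => g₃ r (φ x) (ψ y), fun x y z => hD _ _ _⟩

/-! ### Tao's lemma: diagonals have full slice rank -/

section Tao

variable {m n : Type*} [Fintype n]

/-- Subadditivity of `Matrix.rank` (over a field). [folklore] -/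
private theorem rank_add_le' [DecidableEq n] (A B : Matrix m n K) :
    (A + B).rank ≤ A.rank + B.rank := by
  unfold Matrix.rank
  rw [Matrix.mulVecLin_add]
  calc Module.finrank K (LinearMap.range (A.mulVecLin + B.mulVecLin))
      ≤ Module.finrank K ↥(LinearMap.range A.mulVecLin ⊔ LinearMap.range B.mulVecLin) := by
        apply Submodule.finrank_mono
        rintro _ ⟨v, rfl⟩
        exact Submodule.add_mem_sup ⟨v, rfl⟩ ⟨v, rfl⟩
    _ ≤ _ := Submodule.finrank_add_le_finrank_add_finrank _ _

/-- `rank (Σᵢ Aᵢ) ≤ Σᵢ rank Aᵢ`. [folklore] -/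
private theorem rank_sum_le' [DecidableEq n] {η : Type*} (s : Finset η) (A : η → Matrix m n K) :
    (∑ i ∈ s, A i).rank ≤ ∑ i ∈ s, (A i).rank := by
  classical
  induction s using Finset.induction_on with
  | empty => simp
  | insert a s ha ih =>
    rw [Finset.sum_insert ha, Finset.sum_insert ha]
    exact (rank_add_le' _ _).trans (by omega)

/-- In a subspace `V` of `K^X` there is a vector whose support has at least `dim V` elements: a
vector `u ∈ V` of maximal support works, for otherwise some nonzero `r ∈ V` vanishes on the
support of `u` and `u + r` has larger support (BCCGNSU 2017, proof of Lemma 4.7, "Let `u ∈ V`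
have maximal support … `|Σ| ≥ dim V`").
[cite: BlasiakChurchCohnGrochowNaslundSawinUmans2017, Lemma 4.7 (proof)] -/
theorem exists_mem_finrank_le_card_support [Fintype X] [DecidableEq K]
    (V : Submodule K (X → K)) :
    ∃ u ∈ V, Module.finrank K V ≤ (univ.filter fun x => u x ≠ 0).card := by
  classical
  -- supports realised by members of `V`
  set T : Finset (Finset X) := univ.filter fun S => ∃ h ∈ V, (univ.filter fun x => h x ≠ 0) = S
    with hT
  have hTne : T.Nonempty := by
    refine ⟨∅, ?_⟩
    simp only [hT, mem_filter, mem_univ, true_and]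
    exact ⟨0, V.zero_mem, by simp⟩
  obtain ⟨S, hST, hmax⟩ := T.exists_max_image Finset.card hTne
  obtain ⟨u, huV, rfl⟩ := (mem_filter.1 hST).2
  refine ⟨u, huV, ?_⟩
  by_contra hlt
  push Not at hlt
  set S : Finset X := univ.filter fun x => u x ≠ 0 with hS
  -- restriction of `V` to the coordinates in `S` is not injective
  set ρ : V →ₗ[K] (S → K) := (LinearMap.funLeft K K ((↑) : S → X)) ∘ₗ V.subtype with hρ
  have hdim : Module.finrank K (S → K) < Module.finrank K V := by
    simpa [Module.finrank_fintype_fun_eq_card] using hlt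
  obtain ⟨r, hr, hr0⟩ := Submodule.exists_mem_ne_zero_of_ne_bot
    (LinearMap.ker_ne_bot_of_finrank_lt hdim (f := ρ))
  have hrS : ∀ x ∈ S, (r : X → K) x = 0 := by
    intro x hx
    have := congr_fun (LinearMap.mem_ker.1 hr) ⟨x, hx⟩
    simpa [hρ] using this
  have hr0' : (r : X → K) ≠ 0 := fun h => hr0 (Subtype.ext h)
  obtain ⟨x₀, hx₀⟩ : ∃ x₀, (r : X → K) x₀ ≠ 0 := by
    by_contra hall
    push Not at hall
    exact hr0' (funext hall)
  have hx₀S : x₀ ∉ S := fun h => hx₀ (hrS x₀ h)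
  have hux₀ : u x₀ = 0 := by
    simpa [hS] using hx₀S
  -- the larger support
  set S' : Finset X := univ.filter fun x => (u + r) x ≠ 0 with hS'
  have hS'T : S' ∈ T := by
    simp only [hT, mem_filter, mem_univ, true_and]
    exact ⟨u + r, V.add_mem huV r.2, rfl⟩
  have hsub : S ⊂ S' := by
    rw [Finset.ssubset_iff_of_subset]
    · refine ⟨x₀, ?_, hx₀S⟩
      simp [hS', Pi.add_apply, hux₀, hx₀]
    · intro x hx
      have hux : u x ≠ 0 := by simpa [hS] using hx
      simp [hS', Pi.add_apply, hrS x hx, hux]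
  exact absurd (hmax S' hS'T) (not_le.2 (Finset.card_lt_card hsub))

/-- **Tao's lemma** (BCCGNSU 2017, Lemma 4.7: "If `F : X × Y × Z → 𝔽` is a diagonal, then
`slicerank(F) = tensorrank(F) = |X|`"; the content is `≥`): if `D : X³ → K` vanishes off the
diagonal and is nonzero on it, then every slice decomposition of `D` has at least `|X|` slices.
Tao's proof as printed there: contract a vector `u` of maximal support in the annihilator of the
`x`-slices; the result is a `Y × Z` matrix of rank `≤ ky + kz` equal to a diagonal matrix with
`|supp u| ≥ |X| - kx` nonzero entries.
[cite: BlasiakChurchCohnGrochowNaslundSawinUmans2017, Lemma 4.7] -/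
theorem HasSliceRankLE.card_le_of_diagonal [Fintype X] [DecidableEq X] {D : X → X → X → K}
    {k : ℕ} (hD : HasSliceRankLE D k) (h0 : ∀ x y z, D x y z ≠ 0 → x = y ∧ y = z)
    (h1 : ∀ x, D x x x ≠ 0) : Fintype.card X ≤ k := by
  classical
  obtain ⟨kx, ky, kz, hk, f₁, g₁, f₂, g₂, f₃, g₃, hdec⟩ := hD
  -- the matrix of the `x`-slices and the annihilator `V` of its rows
  set F : Matrix (Fin kx) X K := Matrix.of fun r x => f₁ r x with hF
  set V : Submodule K (X → K) := LinearMap.ker F.mulVecLin with hV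
  have hVdim : Fintype.card X ≤ Module.finrank K V + kx := by
    have h := LinearMap.finrank_range_add_finrank_ker F.mulVecLin
    have hr : Module.finrank K (LinearMap.range F.mulVecLin) ≤ kx := by
      simpa [Matrix.rank] using Matrix.rank_le_card_height F
    rw [Module.finrank_fintype_fun_eq_card, ← hV] at h
    omega
  obtain ⟨u, huV, hu⟩ := exists_mem_finrank_le_card_support V
  have huF : ∀ r, ∑ x, f₁ r x * u x = 0 := by
    intro r
    have h := congr_fun (LinearMap.mem_ker.1 huV) r
    simpa [hF, Matrix.mulVec, dotProduct] using h
  -- contract the decomposition against `u`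
  set M : Matrix X X K := Matrix.of fun y z => ∑ x, u x * D x y z with hM
  have hMdiag : M = Matrix.diagonal fun y => u y * D y y y := by
    ext y z
    simp only [hM, Matrix.of_apply, Matrix.diagonal_apply]
    by_cases hyz : y = z
    · subst hyz
      rw [if_pos rfl, Finset.sum_eq_single y]
      · intro x _ hxy
        have : D x y y = 0 := by
          by_contra hne
          exact hxy (h0 x y y hne).1
        simp [this]
      · simp
    · rw [if_neg hyz]
      refine Finset.sum_eq_zero fun x _ => ?_
      have : D x y z = 0 := by
        by_contra hne
        exact hyz (h0 x y z hne).2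
      simp [this]
  have hrank_ge : (univ.filter fun x => u x ≠ 0).card ≤ M.rank := by
    rw [hMdiag, Matrix.rank_diagonal, Fintype.card_subtype]
    refine (Finset.card_le_card fun x hx => ?_)
    simp only [mem_filter, mem_univ, true_and] at hx ⊢
    exact mul_ne_zero hx (h1 x)
  have hMdec : M = (∑ r, Matrix.vecMulVec (f₂ r) fun z => ∑ x, u x * g₂ r x z) +
      ∑ r, Matrix.vecMulVec (fun y => ∑ x, u x * g₃ r x y) (f₃ r) := by
    ext y z
    simp only [hM, Matrix.of_apply, Matrix.add_apply, Matrix.sum_apply, Matrix.vecMulVec_apply]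
    have step : ∀ x, u x * D x y z = (∑ r, (f₁ r x * u x) * g₁ r y z) +
        ((∑ r, f₂ r y * (u x * g₂ r x z)) + ∑ r, (u x * g₃ r x y) * f₃ r z) := by
      intro x
      rw [hdec x y z, mul_add, mul_add, Finset.mul_sum, Finset.mul_sum, Finset.mul_sum, add_assoc]
      congr 1
      · exact Finset.sum_congr rfl fun r _ => by ring
      · congr 1
        · exact Finset.sum_congr rfl fun r _ => by ring
        · exact Finset.sum_congr rfl fun r _ => by ring
    simp_rw [step]
    rw [Finset.sum_add_distrib, Finset.sum_add_distrib]
    have hzero : ∑ x, ∑ r, f₁ r x * u x * g₁ r y z = 0 := by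
      rw [Finset.sum_comm]
      refine Finset.sum_eq_zero fun r _ => ?_
      rw [← Finset.sum_mul, huF r, zero_mul]
    rw [hzero, zero_add]
    congr 1
    · rw [Finset.sum_comm]
      exact Finset.sum_congr rfl fun r _ => by rw [Finset.mul_sum]
    · rw [Finset.sum_comm]
      exact Finset.sum_congr rfl fun r _ => by rw [Finset.sum_mul]
  have hrank_le : M.rank ≤ ky + kz := by
    rw [hMdec]
    refine (rank_add_le' _ _).trans (add_le_add ?_ ?_)
    · refine (rank_sum_le' _ _).trans ?_
      calc ∑ r : Fin ky, (Matrix.vecMulVec (f₂ r) fun z => ∑ x, u x * g₂ r x z).rank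
          ≤ ∑ _r : Fin ky, 1 := Finset.sum_le_sum fun r _ => Matrix.rank_vecMulVec_le _ _
        _ = ky := by simp
    · refine (rank_sum_le' _ _).trans ?_
      calc ∑ r : Fin kz, (Matrix.vecMulVec (fun y => ∑ x, u x * g₃ r x y) (f₃ r)).rank
          ≤ ∑ _r : Fin kz, 1 := Finset.sum_le_sum fun r _ => Matrix.rank_vecMulVec_le _ _
        _ = kz := by simp
  omega

end Tao

/-- Tao's lemma pulled back along three maps `s, t, u : ι → X, Y, Z`: if
`D (s i) (t j) (u l) ≠ 0 ↔ i = j = l`, then `|ι| ≤ k` for every `k`-slice decomposition of `D`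
(BCCGNSU 2017, proof of Prop. 4.8: restrict, then apply Lemma 4.7).
[cite: BlasiakChurchCohnGrochowNaslundSawinUmans2017, Prop. 4.8 (proof)] -/
theorem HasSliceRankLE.card_le_of_matching {D : X → Y → Z → K} {k : ℕ} (hD : HasSliceRankLE D k)
    {ι : Type*} [Fintype ι] (s : ι → X) (t : ι → Y) (u : ι → Z)
    (h : ∀ i j l, D (s i) (t j) (u l) ≠ 0 ↔ (i = j ∧ j = l)) : Fintype.card ι ≤ k := by
  classical
  refine (hD.comp s t u).card_le_of_diagonal (fun i j l hne => (h i j l).1 hne) fun i => ?_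
  exact (h i i i).2 ⟨rfl, rfl⟩

/-! ### Slice rank of a tensor product with an arbitrary tensor (BCCGNSU Prop. 4.2) -/

/-- **BCCGNSU 2017, Prop. 4.2** (second claim, "`slicerank(F ⊗ G) ≤ slicerank(F) ·
max(|X″|,|Y″|,|Z″|)`"), in the cubical case `X″ = Y″ = Z″ = W`: a `k`-slice decomposition of `D`
gives a `k|W|`-slice decomposition of `(D ⊗ E)((x,x'),(y,y'),(z,z')) = D(x,y,z) E(x',y',z')`, by
expanding `E(x',y',z') = Σ_η δ_η(x') E(η,y',z')` in the `x`-slices (and similarly for `y`, `z`).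
[cite: BlasiakChurchCohnGrochowNaslundSawinUmans2017, Prop. 4.2] -/
theorem HasSliceRankLE.mul_tensor {D : X → Y → Z → K} {k : ℕ} (hD : HasSliceRankLE D k)
    {W : Type*} [Fintype W] [DecidableEq W] (E : W → W → W → K) :
    HasSliceRankLE (fun (x : X × W) (y : Y × W) (z : Z × W) => D x.1 y.1 z.1 * E x.2 y.2 z.2)
      (k * Fintype.card W) := by
  obtain ⟨kx, ky, kz, hle, f₁, g₁, f₂, g₂, f₃, g₃, hdec⟩ := hD
  have h := hasSliceRankLE_of_fintype
    (fun (x : X × W) (y : Y × W) (z : Z × W) => D x.1 y.1 z.1 * E x.2 y.2 z.2)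
    (R₁ := Fin kx × W) (R₂ := Fin ky × W) (R₃ := Fin kz × W)
    (fun r x => f₁ r.1 x.1 * if x.2 = r.2 then 1 else 0)
    (fun r y z => g₁ r.1 y.1 z.1 * E r.2 y.2 z.2)
    (fun r y => f₂ r.1 y.1 * if y.2 = r.2 then 1 else 0)
    (fun r x z => g₂ r.1 x.1 z.1 * E x.2 r.2 z.2)
    (fun r z => f₃ r.1 z.1 * if z.2 = r.2 then 1 else 0)
    (fun r x y => g₃ r.1 x.1 y.1 * E x.2 y.2 r.2) ?_
  · refine h.mono ?_
    simp only [Fintype.card_prod, Fintype.card_fin]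
    nlinarith [Nat.zero_le (Fintype.card W)]
  · rintro ⟨x, x'⟩ ⟨y, y'⟩ ⟨z, z'⟩
    simp only
    rw [hdec x y z, add_mul, add_mul, Finset.sum_mul, Finset.sum_mul, Finset.sum_mul]
    congr 1
    congr 1
    · rw [Fintype.sum_prod_type]
      refine Finset.sum_congr rfl fun r _ => ?_
      rw [Finset.sum_eq_single x']
      · simp; ring
      · intro w _ hw; simp [Ne.symm hw]
      · simp
    · rw [Fintype.sum_prod_type]
      refine Finset.sum_congr rfl fun r _ => ?_
      rw [Finset.sum_eq_single y']
      · simp; ring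
      · intro w _ hw; simp [Ne.symm hw]
      · simp
    · rw [Fintype.sum_prod_type]
      refine Finset.sum_congr rfl fun r _ => ?_
      rw [Finset.sum_eq_single z']
      · simp; ring
      · intro w _ hw; simp [Ne.symm hw]
      · simp

/-! ### From a "triangle-covered" tensor-rank decomposition to a slice decomposition -/

/-- If `D = Σ_ω Fx ω ⊗ Fy ω ⊗ Fz ω` (a rank-one decomposition indexed by a finite `Ω`) and `Ω` is
split into three classes (`c ω = 0, 1, 2`) such that on class `0` the factor `Fx ω` only depends
on `πx ω ∈ Sx`, on class `1` the factor `Fy ω` only on `πy ω ∈ Sy`, and on class `2` the factor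
`Fz ω` only on `πz ω ∈ Sz`, then collecting terms gives a slice decomposition with
`|Sx| + |Sy| + |Sz|` slices (the step "Therefore we can collect terms above to write
`F^{⊗n} = Σ_{u_a ≤ n u_bound} f_a E_a + …`; this decomposition exhibits a bound on the slice rank"
in the proof of BCCGNSU 2017, Thm. 4.10).
[cite: BlasiakChurchCohnGrochowNaslundSawinUmans2017, Thm. 4.10 (proof)] -/
theorem hasSliceRankLE_of_cover {Ω : Type*} [Fintype Ω] (D : X → Y → Z → K)
    (Fx : Ω → X → K) (Fy : Ω → Y → K) (Fz : Ω → Z → K)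
    (hD : ∀ x y z, D x y z = ∑ ω, Fx ω x * Fy ω y * Fz ω z) (c : Ω → Fin 3)
    {Sx Sy Sz : Type*} [Fintype Sx] [Fintype Sy] [Fintype Sz] [DecidableEq Sx] [DecidableEq Sy]
    [DecidableEq Sz]
    (πx : Ω → Sx) (φ : Sx → X → K) (hx : ∀ ω, c ω = 0 → Fx ω = φ (πx ω))
    (πy : Ω → Sy) (χ : Sy → Y → K) (hy : ∀ ω, c ω = 1 → Fy ω = χ (πy ω))
    (πz : Ω → Sz) (ψ : Sz → Z → K) (hz : ∀ ω, c ω = 2 → Fz ω = ψ (πz ω)) :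
    HasSliceRankLE D (Fintype.card Sx + Fintype.card Sy + Fintype.card Sz) := by
  classical
  refine hasSliceRankLE_of_fintype D
    φ (fun s y z => ∑ ω ∈ univ.filter (fun ω => c ω = 0 ∧ πx ω = s), Fy ω y * Fz ω z)
    χ (fun s x z => ∑ ω ∈ univ.filter (fun ω => c ω = 1 ∧ πy ω = s), Fx ω x * Fz ω z)
    ψ (fun s x y => ∑ ω ∈ univ.filter (fun ω => c ω = 2 ∧ πz ω = s), Fx ω x * Fy ω y)
    fun x y z => ?_
  rw [hD x y z]
  -- split the sum over the three classes
  have hsplit : ∑ ω, Fx ω x * Fy ω y * Fz ω z =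
      (∑ ω ∈ univ.filter (fun ω => c ω = 0), Fx ω x * Fy ω y * Fz ω z) +
      (∑ ω ∈ univ.filter (fun ω => c ω = 1), Fx ω x * Fy ω y * Fz ω z) +
      (∑ ω ∈ univ.filter (fun ω => c ω = 2), Fx ω x * Fy ω y * Fz ω z) := by
    rw [← Finset.sum_fiberwise_of_maps_to (g := c) (t := (univ : Finset (Fin 3)))
      (fun ω _ => mem_univ _)]
    simp only [Fin.sum_univ_three]
  rw [hsplit]
  congr 1
  congr 1
  · rw [← Finset.sum_fiberwise_of_maps_to (g := πx) (t := (univ : Finset Sx))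
      (fun ω _ => mem_univ _)]
    refine Finset.sum_congr rfl fun s _ => ?_
    rw [Finset.filter_filter, Finset.mul_sum]
    refine Finset.sum_congr rfl fun ω hω => ?_
    obtain ⟨h0, hs⟩ := (mem_filter.1 hω).2
    rw [hx ω h0, hs]; ring
  · rw [← Finset.sum_fiberwise_of_maps_to (g := πy) (t := (univ : Finset Sy))
      (fun ω _ => mem_univ _)]
    refine Finset.sum_congr rfl fun s _ => ?_
    rw [Finset.filter_filter, Finset.mul_sum]
    refine Finset.sum_congr rfl fun ω hω => ?_
    obtain ⟨h0, hs⟩ := (mem_filter.1 hω).2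
    rw [hy ω h0, hs]; ring
  · rw [← Finset.sum_fiberwise_of_maps_to (g := πz) (t := (univ : Finset Sz))
      (fun ω _ => mem_univ _)]
    refine Finset.sum_congr rfl fun s _ => ?_
    rw [Finset.filter_filter, Finset.mul_sum]
    refine Finset.sum_congr rfl fun ω hω => ?_
    obtain ⟨h0, hs⟩ := (mem_filter.1 hω).2
    rw [hz ω h0, hs]; ring

end SliceRank

/-! ### Tricolored sum-free sets (BCCGNSU 2017, Def. 3.1) and Prop. 4.8 -/

section TSF

variable {H : Type*} [AddCommGroup H] {ι : Type*}

/-- **Tricolored sum-free set** in an abelian group `H` (BCCGNSU 2017, Def. 3.1), in functional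
form: three families `s t u : ι → H` with `s i + t j + u k = 0 ↔ i = j = k`. (Def. 3.1 speaks of
a 3-dimensional perfect matching `M ⊆ S × T × U`; indexing `M` by `ι` and taking the three
projections gives this form, and conversely `S, T, U` are the ranges of `s, t, u`, which are
injective by `IsTricoloredSumFree.injective_left` etc.; the cardinality of the set is `|ι|`.)
[cite: BlasiakChurchCohnGrochowNaslundSawinUmans2017, Def. 3.1] -/
def IsTricoloredSumFree (s t u : ι → H) : Prop :=
  ∀ i j k, s i + t j + u k = 0 ↔ (i = j ∧ j = k)

namespace IsTricoloredSumFree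

variable {s t u : ι → H}

/-- The matched triples sum to zero.
[cite: BlasiakChurchCohnGrochowNaslundSawinUmans2017, Def. 3.1] -/
theorem sum_eq_zero (h : IsTricoloredSumFree s t u) (i : ι) : s i + t i + u i = 0 :=
  (h i i i).2 ⟨rfl, rfl⟩

/-- The first family of a tricolored sum-free set is injective (it enumerates the set `S` of
Def. 3.1). [cite: BlasiakChurchCohnGrochowNaslundSawinUmans2017, Def. 3.1] -/
theorem injective_left (h : IsTricoloredSumFree s t u) : Function.Injective s := by
  intro i j hij
  have h0 := h.sum_eq_zero j
  rw [← hij] at h0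
  exact ((h i j j).1 h0).1

/-- The second family of a tricolored sum-free set is injective (it enumerates `T`).
[cite: BlasiakChurchCohnGrochowNaslundSawinUmans2017, Def. 3.1] -/
theorem injective_middle (h : IsTricoloredSumFree s t u) : Function.Injective t := by
  intro i j hij
  have h0 := h.sum_eq_zero j
  rw [← hij] at h0
  exact ((h j i j).1 h0).1.symm

/-- The third family of a tricolored sum-free set is injective (it enumerates `U`).
[cite: BlasiakChurchCohnGrochowNaslundSawinUmans2017, Def. 3.1] -/
theorem injective_right (h : IsTricoloredSumFree s t u) : Function.Injective u := by
  intro i j hij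
  have h0 := h.sum_eq_zero j
  rw [← hij] at h0
  exact ((h j j i).1 h0).2.symm

/-- Tricolored sum-free sets are transported by injective homomorphisms. [folklore] -/
theorem map (h : IsTricoloredSumFree s t u) {H' : Type*} [AddCommGroup H'] (f : H →+ H')
    (hf : Function.Injective f) : IsTricoloredSumFree (f ∘ s) (f ∘ t) (f ∘ u) := by
  intro i j k
  rw [← h i j k]
  simp only [Function.comp_apply, ← map_add]
  exact map_eq_zero_iff f hf

/-- Sub-families of a tricolored sum-free set (along an injection of index types) are tricolored
sum-free. [folklore] -/
theorem comp (h : IsTricoloredSumFree s t u) {ι' : Type*} {e : ι' → ι}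
    (he : Function.Injective e) : IsTricoloredSumFree (s ∘ e) (t ∘ e) (u ∘ e) := by
  intro i j k
  simp only [Function.comp_apply]
  rw [h (e i) (e j) (e k), he.eq_iff, he.eq_iff]

/-- **BCCGNSU 2017, Prop. 4.8** ("If `M` is a tricolored sum-free set in an abelian group `H`,
then `|M| ≤ slicerank(D_H)`", `D_H(x,y,z) = 1` if `x + y + z = 0` and `0` otherwise, over any
field): the size of a tricolored sum-free set is at most the number of slices of any slice
decomposition of `D_H`. [cite: BlasiakChurchCohnGrochowNaslundSawinUmans2017, Prop. 4.8] -/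
theorem card_le [Fintype ι] [DecidableEq H] {K : Type*} [Field K] (h : IsTricoloredSumFree s t u)
    {k : ℕ} (hD : HasSliceRankLE (fun x y z : H => if x + y + z = 0 then (1 : K) else 0) k) :
    Fintype.card ι ≤ k :=
  hD.card_le_of_matching s t u fun i j l => by simp [h i j l]

end IsTricoloredSumFree

end TSF

end Literature.Combinatorics.Additive
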